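import Summits.ValiantsHypothesis.ValiantsHypothesis.Theorems.LacunarySymmetroidMatrixDescartesVLawCoreSameSide

/-!
# `MatrixDescartes` (stmt-ValiantsHypothesis-18050), line `Lift` — the STAR core lemma on the CLOSED kernel window:
# boundary letters at signed gap ratio `γ = −1` (opposite side, EQUAL gap) and `γ = 2` (same side, DOUBLE gap)

HONEST FRAMING.  Cell `pub-symmetroid`, seat `val-sym-mdr-p2` (gen 3); helper `--supports` the crux
`Theses.LacunarySymmetroid.MatrixDescartes`, NO closure claim.  Extension of `…VLawCore.lean` / `…VLawCoreTwo.lean` /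
`…VLawCoreSameSide.lean` (gen 2: the open window `γ ∈ (−1,0) ∪ (1,2)`); part 1 of 2 (entries and bookkeeping; the
positivity statement `core_pos₄` is `…VLawCoreClosed.lean`), consumed by `…FanLawThree.lean` (closed-window fan law).
Nothing here bears on `stub_twoSided` in general, the crux in its window, `DoorA26`/`DoorA34`, or `VP ≠ VNP`.

THE OBSERVATION.  In the Gram decomposition `M_ij = v_iᵀH(s)v_j = ∑_letters Ĝ_ij · D_i D_j [w_i, w_j, w_s]φ + δ_ij slack_i`
(`w = (u^a)⁻¹` the weight of the factoring letter, `D_i = w_s − w_i`, `φ` the weight of the letter as a function of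
`w`) the two BOUNDARY weights of the kernel-positivity window have POINT-MASS second divided differences:
`φ(w) = w⁻¹` (a letter on the opposite side of the pivot with gap EQUAL to the factoring gap `a`, `γ = −1`):
`[p,q,t] w⁻¹ = (p q t)⁻¹`, and `φ(w) = w²` (a letter on the same side with gap exactly `2a`, `γ = 2`): `[p,q,t] w² = 1`.
Both give RANK-ONE nonnegative Gram blocks `s^a (∑ e_i u_i^a v_i)ᵀ B (∑ e_j u_j^a v_j)` and `(∑ e_i v_i)ᵀ E (∑ e_j v_j)`,
so the quadratic form of `H(s)` on the span of kernel vectors whose Rayleigh slopes point towards `s` is still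
NONNEGATIVE; STRICT positivity is obtained here from ONE positive DEFINITE companion letter (open or boundary)
together with linear independence of the kernel vectors (which the chain lemma supplies for the prefix):
`VLawCoreClosed.core_pos₄` (part 2).  THIS FILE: the point-mass divided-difference identities (`offdiag_inv`,
`diag_inv`, `offdiag_sq`, `diag_sq`), the four-family entries `entry_offdiag₄` / `entry_diag₄`, and `rearrange₄`.  (Per-node nondegeneracy alone — the strictness mechanism of `…VLawCore` — does not suffice at the
boundary; gen 2's census.)  [folklore] Löwner-type kernel positivity; elementary given the gen-2 files.
-/

-- layout Summits/ValiantsHypothesis/ValiantsHypothesis forces the duplicated namespace component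
set_option linter.dupNamespace false

namespace Summit.ValiantsHypothesis.ValiantsHypothesis.Theorems.LacunarySymmetroidMatrixDescartes

open MeasureTheory Set Filter Topology Matrix Finset
open scoped BigOperators
open VLawNormalForm VLawCore VLawCoreTwo

namespace VLawCoreBoundary

/-! ## Point-mass divided differences (pure algebra) -/

section Algebra

/-- Second divided difference of `w ↦ w⁻¹` in cleared form: with `P = p⁻¹`, `Qv = q⁻¹`, `T = t⁻¹`,
`(t−q)·P − (t−p)·Qv + (q−p)·T = (q−p)(t−p)(t−q)·(P·Qv·T)`. [folklore] -/
theorem offdiag_inv {p q t P Qv T : ℝ} (hp : P = p⁻¹) (hq : Qv = q⁻¹) (ht : T = t⁻¹) (hp0 : p ≠ 0)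
    (hq0 : q ≠ 0) (ht0 : t ≠ 0) :
    (t - q) * P - (t - p) * Qv + (q - p) * T = (q - p) * (t - p) * (t - q) * (P * Qv * T) := by
  subst hp hq ht
  field_simp
  ring

/-- Taylor form of `w ↦ w⁻¹` at `p`: `T − P = (t−p)²·(P·P·T) + (t−p)·(−P²)` (`P = p⁻¹`, `T = t⁻¹`). [folklore] -/
theorem diag_inv {p t P T : ℝ} (hp : P = p⁻¹) (ht : T = t⁻¹) (hp0 : p ≠ 0) (ht0 : t ≠ 0) :
    T - P = (t - p) * (t - p) * (P * P * T) + (t - p) * (-(P ^ 2)) := by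
  subst hp ht
  field_simp
  ring

/-- Second divided difference of `w ↦ w²`: `(t−q)p² − (t−p)q² + (q−p)t² = (q−p)(t−p)(t−q)`. [folklore] -/
theorem offdiag_sq (p q t : ℝ) :
    (t - q) * p ^ 2 - (t - p) * q ^ 2 + (q - p) * t ^ 2 = (q - p) * (t - p) * (t - q) := by ring

/-- Taylor form of `w ↦ w²` at `p`: `t² − p² = (t−p)² + (t−p)·(2p)`. [folklore] -/
theorem diag_sq (p t : ℝ) : t ^ 2 - p ^ 2 = (t - p) * (t - p) + (t - p) * (2 * p) := by ring

/-- Weight bookkeeping for the boundary letters: `u^a = ((u^a)⁻¹)⁻¹` and `((u^a)^2)⁻¹ = ((u^a)⁻¹)^2`. [folklore] -/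
theorem boundary_pow (a : ℕ) (u : ℝ) : u ^ a = ((u ^ a)⁻¹)⁻¹ ∧ ((u ^ a) ^ 2)⁻¹ = ((u ^ a)⁻¹) ^ 2 := by
  constructor
  · rw [inv_inv]
  · rw [inv_pow]

end Algebra

/-! ## Entries of the compressed matrix for the four-family H-form -/

section Entries

variable {ι : Type*} [Fintype ι] {κ μ ν ξ : Type*} [Fintype κ] [Fintype μ] [Fintype ν] [Fintype ξ]

omit [Fintype ι] in
/-- The four-family H-form as a one-family H-form over the disjoint union of the letter families. [folklore] -/
theorem hform₄_eq (J P : Matrix ι ι ℝ) (Q : κ → Matrix ι ι ℝ) (R : μ → Matrix ι ι ℝ) (B : ν → Matrix ι ι ℝ)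
    (E : ξ → Matrix ι ι ℝ) (w : ℝ) (gq : κ → ℝ) (gr : μ → ℝ) (gb : ν → ℝ) (ge : ξ → ℝ) :
    J + w • P + ∑ l, gq l • Q l + ∑ m, gr m • R m + ∑ p, gb p • B p + ∑ r, ge r • E r
      = J + w • P + ∑ x : κ ⊕ μ ⊕ ν ⊕ ξ,
          (Sum.elim gq (Sum.elim gr (Sum.elim gb ge)) x) • (Sum.elim Q (Sum.elim R (Sum.elim B E)) x) := by
  rw [Fintype.sum_sum_type, Fintype.sum_sum_type, Fintype.sum_sum_type]
  simp only [Sum.elim_inl, Sum.elim_inr]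
  abel

/-- **Off-diagonal entry, four families** (open letters `Q l`, `R m` as in `…VLawCoreTwo`; boundary letters `B p`
with weight `u^a` and `E r` with weight `((u^a)^2)⁻¹`). [folklore] -/
theorem entry_offdiag₄ {a : ℕ} (ha : 0 < a) {b n : κ → ℕ} (hnb : ∀ l, n l + b l + 1 = a) (hb : ∀ l, 0 < b l)
    {c n' b' : μ → ℕ} (hnb' : ∀ m, n' m + b' m + 1 = a) (hb' : ∀ m, 0 < b' m) (hc : ∀ m, c m + b' m = 2 * a)
    {J P : Matrix ι ι ℝ} {Q : κ → Matrix ι ι ℝ} {R : μ → Matrix ι ι ℝ} {B : ν → Matrix ι ι ℝ}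
    {E : ξ → Matrix ι ι ℝ} (hJ : J.IsSymm) (hP : P.IsSymm)
    (hQ : ∀ l, (Q l).IsSymm) (hR : ∀ m, (R m).IsSymm) (hB : ∀ p, (B p).IsSymm) (hE : ∀ r, (E r).IsSymm)
    {ui uj s : ℝ} (hui : 0 < ui) (huj : 0 < uj) (hs : 0 < s)
    (hij : ui ≠ uj) {vi vj : ι → ℝ}
    (hi : (J + (ui ^ a)⁻¹ • P + ∑ l, ui ^ (b l) • Q l + ∑ m, (ui ^ (c m))⁻¹ • R m
      + ∑ p, ui ^ a • B p + ∑ r, ((ui ^ a) ^ 2)⁻¹ • E r) *ᵥ vi = 0)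
    (hj : (J + (uj ^ a)⁻¹ • P + ∑ l, uj ^ (b l) • Q l + ∑ m, (uj ^ (c m))⁻¹ • R m
      + ∑ p, uj ^ a • B p + ∑ r, ((uj ^ a) ^ 2)⁻¹ • E r) *ᵥ vj = 0) :
    vi ⬝ᵥ ((J + (s ^ a)⁻¹ • P + ∑ l, s ^ (b l) • Q l + ∑ m, (s ^ (c m))⁻¹ • R m
      + ∑ p, s ^ a • B p + ∑ r, ((s ^ a) ^ 2)⁻¹ • E r) *ᵥ vj)
      = (∑ l, (vi ⬝ᵥ (Q l *ᵥ vj)) * (((s ^ a)⁻¹ - (ui ^ a)⁻¹) * ((s ^ a)⁻¹ - (uj ^ a)⁻¹)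
          * (∫ ρ in Ioi (0:ℝ), ρ ^ (n l) / ((ui ^ a)⁻¹ + ρ ^ a) * (((uj ^ a)⁻¹ + ρ ^ a)⁻¹ * ((s ^ a)⁻¹ + ρ ^ a)⁻¹))
          / ∫ ρ in Ioi (0:ℝ), ρ ^ (n l) / (1 + ρ ^ a)))
        + (∑ m, (vi ⬝ᵥ (R m *ᵥ vj)) * (((s ^ a)⁻¹ - (ui ^ a)⁻¹) * ((s ^ a)⁻¹ - (uj ^ a)⁻¹)
          * (∫ ρ in Ioi (0:ℝ), ρ ^ (n' m) / ((s ^ a)⁻¹ + ρ ^ a)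
              * ((ρ ^ a * ((ui ^ a)⁻¹ + ρ ^ a)⁻¹) * (ρ ^ a * ((uj ^ a)⁻¹ + ρ ^ a)⁻¹)))
          / ∫ ρ in Ioi (0:ℝ), ρ ^ (n' m) / (1 + ρ ^ a)))
        + (∑ p, (vi ⬝ᵥ (B p *ᵥ vj)) * (((s ^ a)⁻¹ - (ui ^ a)⁻¹) * ((s ^ a)⁻¹ - (uj ^ a)⁻¹)
          * (ui ^ a * uj ^ a * s ^ a)))
        + ∑ r, (vi ⬝ᵥ (E r *ᵥ vj)) * (((s ^ a)⁻¹ - (ui ^ a)⁻¹) * ((s ^ a)⁻¹ - (uj ^ a)⁻¹)) := by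
  have hna : ∀ l, n l + 2 ≤ a := fun l => by have := hnb l; have := hb l; omega
  have hna' : ∀ m, n' m + 2 ≤ a := fun m => by have := hnb' m; have := hb' m; omega
  have hC : ∀ l, (∫ ρ in Ioi (0:ℝ), ρ ^ (n l) / (1 + ρ ^ a)) ≠ 0 :=
    fun l => (VLawStieltjes.stieltjesConst_pos (hna l)).ne'
  have hC' : ∀ m, (∫ ρ in Ioi (0:ℝ), ρ ^ (n' m) / (1 + ρ ^ a)) ≠ 0 :=
    fun m => (VLawStieltjes.stieltjesConst_pos (hna' m)).ne'
  have hpq : (uj ^ a)⁻¹ - (ui ^ a)⁻¹ ≠ 0 := by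
    intro h
    exact hij ((pow_left_inj₀ hui.le huj.le ha.ne').1 (inv_injective (sub_eq_zero.1 h).symm))
  rw [hform₄_eq] at hi hj
  rw [hform₄_eq]
  have hsymm : ∀ x : κ ⊕ μ ⊕ ν ⊕ ξ, (Sum.elim Q (Sum.elim R (Sum.elim B E)) x).IsSymm := by
    intro x
    rcases x with l | m | p | r
    · exact hQ l
    · exact hR m
    · exact hB p
    · exact hE r
  have hoff := offdiag_identity (κ := κ ⊕ μ ⊕ ν ⊕ ξ) hJ hP hsymm
    (ui ^ a)⁻¹ (uj ^ a)⁻¹ (s ^ a)⁻¹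
    (Sum.elim (fun l => ui ^ (b l)) (Sum.elim (fun m => (ui ^ (c m))⁻¹)
      (Sum.elim (fun _ => ui ^ a) (fun _ => ((ui ^ a) ^ 2)⁻¹))))
    (Sum.elim (fun l => uj ^ (b l)) (Sum.elim (fun m => (uj ^ (c m))⁻¹)
      (Sum.elim (fun _ => uj ^ a) (fun _ => ((uj ^ a) ^ 2)⁻¹))))
    (Sum.elim (fun l => s ^ (b l)) (Sum.elim (fun m => (s ^ (c m))⁻¹)
      (Sum.elim (fun _ => s ^ a) (fun _ => ((s ^ a) ^ 2)⁻¹)))) hi hj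
  refine mul_left_cancel₀ hpq ?_
  rw [hoff, Fintype.sum_sum_type, Fintype.sum_sum_type, Fintype.sum_sum_type]
  simp only [Sum.elim_inl, Sum.elim_inr]
  -- the four families, letter by letter
  have eQ : ∀ l, (vi ⬝ᵥ (Q l *ᵥ vj)) * (((s ^ a)⁻¹ - (uj ^ a)⁻¹) * ui ^ (b l)
        - ((s ^ a)⁻¹ - (ui ^ a)⁻¹) * uj ^ (b l) + ((uj ^ a)⁻¹ - (ui ^ a)⁻¹) * s ^ (b l))
      = ((uj ^ a)⁻¹ - (ui ^ a)⁻¹) * ((vi ⬝ᵥ (Q l *ᵥ vj)) * (((s ^ a)⁻¹ - (ui ^ a)⁻¹) * ((s ^ a)⁻¹ - (uj ^ a)⁻¹)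
          * (∫ ρ in Ioi (0:ℝ), ρ ^ (n l) / ((ui ^ a)⁻¹ + ρ ^ a) * (((uj ^ a)⁻¹ + ρ ^ a)⁻¹ * ((s ^ a)⁻¹ + ρ ^ a)⁻¹))
          / ∫ ρ in Ioi (0:ℝ), ρ ^ (n l) / (1 + ρ ^ a))) := by
    intro l
    have hl := offdiag_integral (hna l) (inv_pos.2 (pow_pos hui a)) (inv_pos.2 (pow_pos huj a))
      (inv_pos.2 (pow_pos hs a)) (VLawStieltjes.integral_stieltjes_one (hnb l) hui)
      (VLawStieltjes.integral_stieltjes_one (hnb l) huj) (VLawStieltjes.integral_stieltjes_one (hnb l) hs)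
    set Kl := ∫ ρ in Ioi (0:ℝ), ρ ^ (n l) / ((ui ^ a)⁻¹ + ρ ^ a) * (((uj ^ a)⁻¹ + ρ ^ a)⁻¹ * ((s ^ a)⁻¹ + ρ ^ a)⁻¹)
      with hKl
    set Cl := ∫ ρ in Ioi (0:ℝ), ρ ^ (n l) / (1 + ρ ^ a) with hCl
    have hCl' : Cl ≠ 0 := hC l
    simp only [mul_div_assoc']
    rw [eq_div_iff hCl']
    linear_combination (-(vi ⬝ᵥ (Q l *ᵥ vj))) * hl
  have eR : ∀ m, (vi ⬝ᵥ (R m *ᵥ vj)) * (((s ^ a)⁻¹ - (uj ^ a)⁻¹) * (ui ^ (c m))⁻¹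
        - ((s ^ a)⁻¹ - (ui ^ a)⁻¹) * (uj ^ (c m))⁻¹ + ((uj ^ a)⁻¹ - (ui ^ a)⁻¹) * (s ^ (c m))⁻¹)
      = ((uj ^ a)⁻¹ - (ui ^ a)⁻¹) * ((vi ⬝ᵥ (R m *ᵥ vj)) * (((s ^ a)⁻¹ - (ui ^ a)⁻¹) * ((s ^ a)⁻¹ - (uj ^ a)⁻¹)
          * (∫ ρ in Ioi (0:ℝ), ρ ^ (n' m) / ((s ^ a)⁻¹ + ρ ^ a)
              * ((ρ ^ a * ((ui ^ a)⁻¹ + ρ ^ a)⁻¹) * (ρ ^ a * ((uj ^ a)⁻¹ + ρ ^ a)⁻¹)))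
          / ∫ ρ in Ioi (0:ℝ), ρ ^ (n' m) / (1 + ρ ^ a))) := by
    intro m
    have hl := offdiag_integral₂ (hna' m) (inv_pos.2 (pow_pos hui a)) (inv_pos.2 (pow_pos huj a))
      (inv_pos.2 (pow_pos hs a)) (VLawStieltjes.integral_stieltjes_one (hnb' m) hui)
      (VLawStieltjes.integral_stieltjes_one (hnb' m) huj) (VLawStieltjes.integral_stieltjes_one (hnb' m) hs)
    rw [(sameSide_pow ha (hc m) hui).1, (sameSide_pow ha (hc m) huj).1, (sameSide_pow ha (hc m) hs).1] at hl
    set Km := ∫ ρ in Ioi (0:ℝ), ρ ^ (n' m) / ((s ^ a)⁻¹ + ρ ^ a)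
        * ((ρ ^ a * ((ui ^ a)⁻¹ + ρ ^ a)⁻¹) * (ρ ^ a * ((uj ^ a)⁻¹ + ρ ^ a)⁻¹)) with hKm
    set Cm := ∫ ρ in Ioi (0:ℝ), ρ ^ (n' m) / (1 + ρ ^ a) with hCm
    have hCm' : Cm ≠ 0 := hC' m
    simp only [mul_div_assoc']
    rw [eq_div_iff hCm']
    linear_combination (-(vi ⬝ᵥ (R m *ᵥ vj))) * hl
  have eB : ∀ p, (vi ⬝ᵥ (B p *ᵥ vj)) * (((s ^ a)⁻¹ - (uj ^ a)⁻¹) * ui ^ a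
        - ((s ^ a)⁻¹ - (ui ^ a)⁻¹) * uj ^ a + ((uj ^ a)⁻¹ - (ui ^ a)⁻¹) * s ^ a)
      = ((uj ^ a)⁻¹ - (ui ^ a)⁻¹) * ((vi ⬝ᵥ (B p *ᵥ vj)) * (((s ^ a)⁻¹ - (ui ^ a)⁻¹) * ((s ^ a)⁻¹ - (uj ^ a)⁻¹)
          * (ui ^ a * uj ^ a * s ^ a))) := by
    intro p
    have hl := offdiag_inv (boundary_pow a ui).1 (boundary_pow a uj).1 (boundary_pow a s).1
      (inv_ne_zero (pow_pos hui a).ne') (inv_ne_zero (pow_pos huj a).ne') (inv_ne_zero (pow_pos hs a).ne')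
    linear_combination (vi ⬝ᵥ (B p *ᵥ vj)) * hl
  have eE : ∀ r, (vi ⬝ᵥ (E r *ᵥ vj)) * (((s ^ a)⁻¹ - (uj ^ a)⁻¹) * ((ui ^ a) ^ 2)⁻¹
        - ((s ^ a)⁻¹ - (ui ^ a)⁻¹) * ((uj ^ a) ^ 2)⁻¹ + ((uj ^ a)⁻¹ - (ui ^ a)⁻¹) * ((s ^ a) ^ 2)⁻¹)
      = ((uj ^ a)⁻¹ - (ui ^ a)⁻¹) * ((vi ⬝ᵥ (E r *ᵥ vj))
          * (((s ^ a)⁻¹ - (ui ^ a)⁻¹) * ((s ^ a)⁻¹ - (uj ^ a)⁻¹))) := by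
    intro r
    rw [(boundary_pow a ui).2, (boundary_pow a uj).2, (boundary_pow a s).2]
    have hl := offdiag_sq (ui ^ a)⁻¹ (uj ^ a)⁻¹ (s ^ a)⁻¹
    linear_combination (vi ⬝ᵥ (E r *ᵥ vj)) * hl
  simp_rw [eQ, eR, eB, eE, ← Finset.mul_sum]
  ring


/-- **Diagonal entry, four families.**  Kernel blocks as off the diagonal, plus the slack
`D_i · (P̂ − ∑ (b/a) u^{a+b} Q̂ + ∑ (c/a) u^a (u^c)⁻¹ R̂ − ∑ (u^a)^2 B̂ + ∑ 2 (u^a)⁻¹ Ê)`. [folklore] -/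
theorem entry_diag₄ {a : ℕ} (ha : 0 < a) {b n : κ → ℕ} (hnb : ∀ l, n l + b l + 1 = a) (hb : ∀ l, 0 < b l)
    {c n' b' : μ → ℕ} (hnb' : ∀ m, n' m + b' m + 1 = a) (hb' : ∀ m, 0 < b' m) (hc : ∀ m, c m + b' m = 2 * a)
    (J P : Matrix ι ι ℝ) (Q : κ → Matrix ι ι ℝ) (R : μ → Matrix ι ι ℝ) (B : ν → Matrix ι ι ℝ)
    (E : ξ → Matrix ι ι ℝ) {ui s : ℝ} (hui : 0 < ui) (hs : 0 < s) {vi : ι → ℝ}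
    (hi : (J + (ui ^ a)⁻¹ • P + ∑ l, ui ^ (b l) • Q l + ∑ m, (ui ^ (c m))⁻¹ • R m
      + ∑ p, ui ^ a • B p + ∑ r, ((ui ^ a) ^ 2)⁻¹ • E r) *ᵥ vi = 0) :
    vi ⬝ᵥ ((J + (s ^ a)⁻¹ • P + ∑ l, s ^ (b l) • Q l + ∑ m, (s ^ (c m))⁻¹ • R m
      + ∑ p, s ^ a • B p + ∑ r, ((s ^ a) ^ 2)⁻¹ • E r) *ᵥ vi)
      = (∑ l, (vi ⬝ᵥ (Q l *ᵥ vi)) * (((s ^ a)⁻¹ - (ui ^ a)⁻¹) * ((s ^ a)⁻¹ - (ui ^ a)⁻¹)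
          * (∫ ρ in Ioi (0:ℝ), ρ ^ (n l) / ((ui ^ a)⁻¹ + ρ ^ a) * (((ui ^ a)⁻¹ + ρ ^ a)⁻¹ * ((s ^ a)⁻¹ + ρ ^ a)⁻¹))
          / ∫ ρ in Ioi (0:ℝ), ρ ^ (n l) / (1 + ρ ^ a)))
        + (∑ m, (vi ⬝ᵥ (R m *ᵥ vi)) * (((s ^ a)⁻¹ - (ui ^ a)⁻¹) * ((s ^ a)⁻¹ - (ui ^ a)⁻¹)
          * (∫ ρ in Ioi (0:ℝ), ρ ^ (n' m) / ((s ^ a)⁻¹ + ρ ^ a)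
              * ((ρ ^ a * ((ui ^ a)⁻¹ + ρ ^ a)⁻¹) * (ρ ^ a * ((ui ^ a)⁻¹ + ρ ^ a)⁻¹)))
          / ∫ ρ in Ioi (0:ℝ), ρ ^ (n' m) / (1 + ρ ^ a)))
        + (∑ p, (vi ⬝ᵥ (B p *ᵥ vi)) * (((s ^ a)⁻¹ - (ui ^ a)⁻¹) * ((s ^ a)⁻¹ - (ui ^ a)⁻¹)
          * (ui ^ a * ui ^ a * s ^ a)))
        + (∑ r, (vi ⬝ᵥ (E r *ᵥ vi)) * (((s ^ a)⁻¹ - (ui ^ a)⁻¹) * ((s ^ a)⁻¹ - (ui ^ a)⁻¹)))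
        + ((s ^ a)⁻¹ - (ui ^ a)⁻¹) * (vi ⬝ᵥ (P *ᵥ vi)
            - ∑ l, ((b l : ℝ) / a) * ui ^ (a + b l) * (vi ⬝ᵥ (Q l *ᵥ vi))
            + ∑ m, ((c m : ℝ) / a) * ui ^ a * (ui ^ (c m))⁻¹ * (vi ⬝ᵥ (R m *ᵥ vi))
            - ∑ p, (ui ^ a) ^ 2 * (vi ⬝ᵥ (B p *ᵥ vi))
            + ∑ r, 2 * (ui ^ a)⁻¹ * (vi ⬝ᵥ (E r *ᵥ vi))) := by
  have hna : ∀ l, n l + 2 ≤ a := fun l => by have := hnb l; have := hb l; omega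
  have hna' : ∀ m, n' m + 2 ≤ a := fun m => by have := hnb' m; have := hb' m; omega
  have hC : ∀ l, (∫ ρ in Ioi (0:ℝ), ρ ^ (n l) / (1 + ρ ^ a)) ≠ 0 :=
    fun l => (VLawStieltjes.stieltjesConst_pos (hna l)).ne'
  have hC' : ∀ m, (∫ ρ in Ioi (0:ℝ), ρ ^ (n' m) / (1 + ρ ^ a)) ≠ 0 :=
    fun m => (VLawStieltjes.stieltjesConst_pos (hna' m)).ne'
  rw [hform₄_eq] at hi
  rw [hform₄_eq, diag_identity (κ := κ ⊕ μ ⊕ ν ⊕ ξ) J P _ (ui ^ a)⁻¹ (s ^ a)⁻¹ _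
    (Sum.elim (fun l => s ^ (b l)) (Sum.elim (fun m => (s ^ (c m))⁻¹)
      (Sum.elim (fun _ => s ^ a) (fun _ => ((s ^ a) ^ 2)⁻¹)))) hi,
    Fintype.sum_sum_type, Fintype.sum_sum_type, Fintype.sum_sum_type]
  simp only [Sum.elim_inl, Sum.elim_inr]
  have hK : ∀ l, ((s ^ a)⁻¹ - (ui ^ a)⁻¹) * ((s ^ a)⁻¹ - (ui ^ a)⁻¹)
      * (∫ ρ in Ioi (0:ℝ), ρ ^ (n l) / ((ui ^ a)⁻¹ + ρ ^ a) * (((ui ^ a)⁻¹ + ρ ^ a)⁻¹ * ((s ^ a)⁻¹ + ρ ^ a)⁻¹))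
      / (∫ ρ in Ioi (0:ℝ), ρ ^ (n l) / (1 + ρ ^ a))
      = s ^ (b l) - ui ^ (b l) + ((s ^ a)⁻¹ - (ui ^ a)⁻¹) * (((b l : ℝ) / a) * ui ^ (a + b l)) := by
    intro l
    have hl := diag_integral (hna l) (inv_pos.2 (pow_pos hui a)) (inv_pos.2 (pow_pos hs a))
      (VLawStieltjes.integral_stieltjes_one (hnb l) hui) (VLawStieltjes.integral_stieltjes_one (hnb l) hs)
      (VLawStieltjes.integral_stieltjes_sq (hnb l) (hb l) hui)
    set Kl := ∫ ρ in Ioi (0:ℝ), ρ ^ (n l) / ((ui ^ a)⁻¹ + ρ ^ a) * (((ui ^ a)⁻¹ + ρ ^ a)⁻¹ * ((s ^ a)⁻¹ + ρ ^ a)⁻¹)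
      with hKl
    set Cl := ∫ ρ in Ioi (0:ℝ), ρ ^ (n l) / (1 + ρ ^ a) with hCl
    have hCl' : Cl ≠ 0 := hC l
    rw [div_eq_iff hCl']
    linear_combination hl
  have hK' : ∀ m, ((s ^ a)⁻¹ - (ui ^ a)⁻¹) * ((s ^ a)⁻¹ - (ui ^ a)⁻¹)
      * (∫ ρ in Ioi (0:ℝ), ρ ^ (n' m) / ((s ^ a)⁻¹ + ρ ^ a)
          * ((ρ ^ a * ((ui ^ a)⁻¹ + ρ ^ a)⁻¹) * (ρ ^ a * ((ui ^ a)⁻¹ + ρ ^ a)⁻¹)))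
      / (∫ ρ in Ioi (0:ℝ), ρ ^ (n' m) / (1 + ρ ^ a))
      = (s ^ (c m))⁻¹ - (ui ^ (c m))⁻¹
        - ((s ^ a)⁻¹ - (ui ^ a)⁻¹) * (((c m : ℝ) / a) * ui ^ a * (ui ^ (c m))⁻¹) := by
    intro m
    have hl := diag_integral₂ (hna' m) (inv_pos.2 (pow_pos hui a)) (inv_pos.2 (pow_pos hs a))
      (VLawStieltjes.integral_stieltjes_one (hnb' m) hui) (VLawStieltjes.integral_stieltjes_one (hnb' m) hs)
      (VLawStieltjes.integral_stieltjes_sq (hnb' m) (hb' m) hui)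
    rw [(sameSide_pow ha (hc m) hui).1, (sameSide_pow ha (hc m) hs).1, (sameSide_pow ha (hc m) hui).2] at hl
    set Km := ∫ ρ in Ioi (0:ℝ), ρ ^ (n' m) / ((s ^ a)⁻¹ + ρ ^ a)
        * ((ρ ^ a * ((ui ^ a)⁻¹ + ρ ^ a)⁻¹) * (ρ ^ a * ((ui ^ a)⁻¹ + ρ ^ a)⁻¹)) with hKm
    set Cm := ∫ ρ in Ioi (0:ℝ), ρ ^ (n' m) / (1 + ρ ^ a) with hCm
    have hCm' : Cm ≠ 0 := hC' m
    rw [div_eq_iff hCm']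
    linear_combination hl
  -- boundary letters: point-mass Taylor forms
  have hKB : ((s ^ a)⁻¹ - (ui ^ a)⁻¹) * ((s ^ a)⁻¹ - (ui ^ a)⁻¹) * (ui ^ a * ui ^ a * s ^ a)
      = s ^ a - ui ^ a + ((s ^ a)⁻¹ - (ui ^ a)⁻¹) * (ui ^ a) ^ 2 := by
    have hl := diag_inv (boundary_pow a ui).1 (boundary_pow a s).1
      (inv_ne_zero (pow_pos hui a).ne') (inv_ne_zero (pow_pos hs a).ne')
    linear_combination (-1 : ℝ) * hl
  have hKE : ((s ^ a)⁻¹ - (ui ^ a)⁻¹) * ((s ^ a)⁻¹ - (ui ^ a)⁻¹)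
      = ((s ^ a) ^ 2)⁻¹ - ((ui ^ a) ^ 2)⁻¹ - ((s ^ a)⁻¹ - (ui ^ a)⁻¹) * (2 * (ui ^ a)⁻¹) := by
    rw [(boundary_pow a ui).2, (boundary_pow a s).2]
    have hl := diag_sq (ui ^ a)⁻¹ (s ^ a)⁻¹
    linear_combination (-1 : ℝ) * hl
  simp_rw [hK, hK', hKB, hKE]
  have e1 : ∑ l, (vi ⬝ᵥ (Q l *ᵥ vi)) * (s ^ (b l) - ui ^ (b l)
        + ((s ^ a)⁻¹ - (ui ^ a)⁻¹) * (((b l : ℝ) / a) * ui ^ (a + b l)))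
      = ∑ l, (s ^ (b l) - ui ^ (b l)) * (vi ⬝ᵥ (Q l *ᵥ vi))
        + ((s ^ a)⁻¹ - (ui ^ a)⁻¹) * ∑ l, ((b l : ℝ) / a) * ui ^ (a + b l) * (vi ⬝ᵥ (Q l *ᵥ vi)) := by
    rw [Finset.mul_sum, ← Finset.sum_add_distrib]
    exact Finset.sum_congr rfl fun l _ => by ring
  have e2 : ∑ m, (vi ⬝ᵥ (R m *ᵥ vi)) * ((s ^ (c m))⁻¹ - (ui ^ (c m))⁻¹
        - ((s ^ a)⁻¹ - (ui ^ a)⁻¹) * (((c m : ℝ) / a) * ui ^ a * (ui ^ (c m))⁻¹))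
      = ∑ m, ((s ^ (c m))⁻¹ - (ui ^ (c m))⁻¹) * (vi ⬝ᵥ (R m *ᵥ vi))
        - ((s ^ a)⁻¹ - (ui ^ a)⁻¹) * ∑ m, ((c m : ℝ) / a) * ui ^ a * (ui ^ (c m))⁻¹ * (vi ⬝ᵥ (R m *ᵥ vi)) := by
    rw [Finset.mul_sum, ← Finset.sum_sub_distrib]
    exact Finset.sum_congr rfl fun m _ => by ring
  have e3 : ∑ p, (vi ⬝ᵥ (B p *ᵥ vi)) * (s ^ a - ui ^ a + ((s ^ a)⁻¹ - (ui ^ a)⁻¹) * (ui ^ a) ^ 2)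
      = ∑ p, (s ^ a - ui ^ a) * (vi ⬝ᵥ (B p *ᵥ vi))
        + ((s ^ a)⁻¹ - (ui ^ a)⁻¹) * ∑ p, (ui ^ a) ^ 2 * (vi ⬝ᵥ (B p *ᵥ vi)) := by
    rw [Finset.mul_sum, ← Finset.sum_add_distrib]
    exact Finset.sum_congr rfl fun p _ => by ring
  have e4 : ∑ r, (vi ⬝ᵥ (E r *ᵥ vi)) * (((s ^ a) ^ 2)⁻¹ - ((ui ^ a) ^ 2)⁻¹
        - ((s ^ a)⁻¹ - (ui ^ a)⁻¹) * (2 * (ui ^ a)⁻¹))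
      = ∑ r, (((s ^ a) ^ 2)⁻¹ - ((ui ^ a) ^ 2)⁻¹) * (vi ⬝ᵥ (E r *ᵥ vi))
        - ((s ^ a)⁻¹ - (ui ^ a)⁻¹) * ∑ r, 2 * (ui ^ a)⁻¹ * (vi ⬝ᵥ (E r *ᵥ vi)) := by
    rw [Finset.mul_sum, ← Finset.sum_sub_distrib]
    exact Finset.sum_congr rfl fun r _ => by ring
  rw [e1, e2, e3, e4]
  ring

/-- Rearrangement of the double sum with four letter families (pure bookkeeping). [folklore] -/
theorem rearrange₄ {k : ℕ} (cc D sl : Fin k → ℝ) (Qh KQ : κ → Fin k → Fin k → ℝ) (CQ : κ → ℝ)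
    (Rh KR : μ → Fin k → Fin k → ℝ) (CR : μ → ℝ) (Bh : ν → Fin k → Fin k → ℝ) (W : Fin k → ℝ) (t : ℝ)
    (Eh : ξ → Fin k → Fin k → ℝ) :
    ∑ i, ∑ j, cc i * cc j * ((∑ l, Qh l i j * (D i * D j * KQ l i j / CQ l))
        + (∑ m, Rh m i j * (D i * D j * KR m i j / CR m))
        + (∑ p, Bh p i j * (D i * D j * (W i * W j * t)))
        + (∑ r, Eh r i j * (D i * D j))
        + if i = j then sl i else 0)
      = (∑ l, (CQ l)⁻¹ * ∑ i, ∑ j, (cc i * D i) * (cc j * D j) * Qh l i j * KQ l i j)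
        + (∑ m, (CR m)⁻¹ * ∑ i, ∑ j, (cc i * D i) * (cc j * D j) * Rh m i j * KR m i j)
        + (∑ p, t * ∑ i, ∑ j, (cc i * D i * W i) * (cc j * D j * W j) * Bh p i j)
        + (∑ r, ∑ i, ∑ j, (cc i * D i) * (cc j * D j) * Eh r i j)
        + ∑ i, cc i ^ 2 * sl i := by
  classical
  have h1 := rearrange cc D sl Qh KQ CQ
  have h2 := rearrange cc D (fun _ => 0) Rh KR CR
  have h3 := rearrange cc D (fun _ => 0) Bh (fun _ i j => W i * W j * t) (fun _ => 1)
  have h4 := rearrange cc D (fun _ => 0) Eh (fun _ _ _ => 1) (fun _ => 1)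
  simp only [ite_self, add_zero, mul_zero, Finset.sum_const_zero, div_one, inv_one, one_mul, mul_one] at h2 h3 h4
  have hsplit : ∀ i j, cc i * cc j * ((∑ l, Qh l i j * (D i * D j * KQ l i j / CQ l))
        + (∑ m, Rh m i j * (D i * D j * KR m i j / CR m))
        + (∑ p, Bh p i j * (D i * D j * (W i * W j * t)))
        + (∑ r, Eh r i j * (D i * D j))
        + if i = j then sl i else 0)
      = cc i * cc j * ((∑ l, Qh l i j * (D i * D j * KQ l i j / CQ l)) + if i = j then sl i else 0)
        + cc i * cc j * (∑ m, Rh m i j * (D i * D j * KR m i j / CR m))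
        + cc i * cc j * (∑ p, Bh p i j * (D i * D j * (W i * W j * t)))
        + cc i * cc j * (∑ r, Eh r i j * (D i * D j)) := fun i j => by ring
  simp_rw [hsplit, Finset.sum_add_distrib]
  rw [h1, h2, h3, h4]
  have h3' : ∀ p, ∑ i, ∑ j, cc i * D i * (cc j * D j) * Bh p i j * (W i * W j * t)
      = t * ∑ i, ∑ j, (cc i * D i * W i) * (cc j * D j * W j) * Bh p i j := by
    intro p
    rw [Finset.mul_sum]
    refine Finset.sum_congr rfl fun i _ => ?_
    rw [Finset.mul_sum]
    refine Finset.sum_congr rfl fun j _ => ?_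
    ring
  simp_rw [h3']
  ring

end Entries


end VLawCoreBoundary

end Summit.ValiantsHypothesis.ValiantsHypothesis.Theorems.LacunarySymmetroidMatrixDescartes
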